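import Mathlib.MeasureTheory.Integral.Lebesgue.Countable
import Mathlib.MeasureTheory.Measure.Map
import Mathlib.Analysis.SpecificLimits.Basic
import Mathlib.MeasureTheory.Constructions.BorelSpace.Basic
import Mathlib.Analysis.SpecialFunctions.Pow.Real
import Mathlib.MeasureTheory.Integral.Bochner.Basic

/-!
# The space `𝓜_{c,C}` of spectral measures and its domination function (DKLM 2026, Part II §1.2)

H. Duminil-Copin, K. K. Kozlowski, P. Lammers, I. Manolescu, *Gaussian free field convergence of
the six-vertex model with `-1 ≤ Δ ≤ -1/2`*, arXiv:2603.06268 (2026) [DKLM2026SixVertexGFF]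
(`paper:arxiv-2603.06268`, chunks p0022–p0024):

> **Definition 29** (The compact space `𝓜_{c,C}`). For `c, C ∈ (0,∞)`, let `𝓜_{c,C}` denote the
> set of positive measures `ν` on `ℝ_{>0} × ℝ`, invariant under `(a,b) ↦ (a,-b)` and satisfying
> the following bounds: (i) `ν[{a ∈ (α,2α)}] ≤ C`, for any `α > 0`, (ii)
> `ν[{(a,|b|) ∈ (0,α) × (β,2β)}] ≤ C(α/β)^c`, for any `β ≥ α > 0`. […]
>
> By construction, these measures have the property that `sup_{ν ∈ 𝓜} ∫ (a ∧ 1/a) dν(a,b) < ∞`.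
> This means that the function `a ∧ 1/a` is a good domination function for applying the
> dominated convergence theorem.
>
> (§1.2.3) For any `ν ∈ 𝓜` and `δ > 0`, denote by `ν^{(δ)} ∈ 𝓜` the measure defined by
> `ν^{(δ)}(U) := ν(δU)` […]. By construction, for every integrable function `f`,
> `∫ f(δa, δb) dν^{(δ)}(a,b) = ∫ f(a,b) dν(a,b)`.

Measures on `ℝ_{>0} × ℝ` are encoded as measures on `ℝ × ℝ` giving no mass to `{a ≤ 0}`.

* `dklmSpaceM c C` — Definition 29; `aStrip j` — the dyadic strips `{2^j < a ≤ 2^{j+1}}`, each of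
  mass `≤ 2C` under bound (i) (`dklmSpaceM_measure_dyadic_le`);
* **`lintegral_min_inv_le`** — the domination bound, quantitatively:
  `∫ (a ∧ 1/a) dν ≤ 12 C` for every `ν ∈ 𝓜_{c,C}` (dyadic decomposition in `a` and bound (i));
* `scaleMeasure δ ν = ν^{(δ)}` (push-forward under `p ↦ p/δ`), `scaleMeasure_apply`
  (`ν^{(δ)}(U) = ν(δU)`), `lintegral_comp_scaleMeasure` (the change of variables), and
  **`scaleMeasure_mem_dklmSpaceM`** (`𝓜_{c,C}` is scale invariant: `ν^{(δ)} ∈ 𝓜`).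

## References

* H. Duminil-Copin, K. K. Kozlowski, P. Lammers, I. Manolescu, arXiv:2603.06268 (2026), Part II,
  Definition 29, eq. (domination) after Lemma 30, and §1.2.3. [DKLM2026SixVertexGFF]
-/

noncomputable section

open MeasureTheory Set

namespace Literature.Probability.LatticeModels.SixVertex

/-! ## 1. Definition 29 -/

/-- **Definition 29 (the space `𝓜_{c,C}`)**: positive measures on `ℝ_{>0} × ℝ` (no mass on
`{a ≤ 0}`), invariant under `(a,b) ↦ (a,-b)`, with (i) `ν{a ∈ (α,2α)} ≤ C` for all `α > 0` and
(ii) `ν{(a,|b|) ∈ (0,α) × (β,2β)} ≤ C (α/β)^c` for all `β ≥ α > 0`.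
[cite: DKLM2026SixVertexGFF, Part II, Definition 29] -/
def dklmSpaceM (c C : ℝ) : Set (Measure (ℝ × ℝ)) :=
  {ν | ν {p | p.1 ≤ 0} = 0 ∧ ν.map (fun p : ℝ × ℝ => (p.1, -p.2)) = ν ∧
    (∀ α : ℝ, 0 < α → ν {p | p.1 ∈ Ioo α (2 * α)} ≤ ENNReal.ofReal C) ∧
    (∀ α β : ℝ, 0 < α → α ≤ β →
      ν {p | p.1 ∈ Ioo 0 α ∧ |p.2| ∈ Ioo β (2 * β)} ≤ ENNReal.ofReal (C * (α / β) ^ c))}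

variable {c C : ℝ} {ν : Measure (ℝ × ℝ)}

/-- `ν ∈ 𝓜_{c,C}` gives no mass to `{a ≤ 0}` (a measure on `ℝ_{>0} × ℝ`). [cite: DKLM2026SixVertexGFF, Part II, Definition 29] -/
theorem dklmSpaceM_nonpos_null (h : ν ∈ dklmSpaceM c C) : ν {p | p.1 ≤ 0} = 0 := h.1

/-- `ν ∈ 𝓜_{c,C}` is invariant under `(a,b) ↦ (a,-b)`. [cite: DKLM2026SixVertexGFF, Part II, Definition 29] -/
theorem dklmSpaceM_map_reflect (h : ν ∈ dklmSpaceM c C) :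
    ν.map (fun p : ℝ × ℝ => (p.1, -p.2)) = ν := h.2.1

/-- Bound (i): `ν{a ∈ (α,2α)} ≤ C`. [cite: DKLM2026SixVertexGFF, Part II, Definition 29 (i)] -/
theorem dklmSpaceM_bound_i (h : ν ∈ dklmSpaceM c C) {α : ℝ} (hα : 0 < α) :
    ν {p | p.1 ∈ Ioo α (2 * α)} ≤ ENNReal.ofReal C := h.2.2.1 α hα

/-- Bound (ii): `ν{(a,|b|) ∈ (0,α) × (β,2β)} ≤ C (α/β)^c` for `β ≥ α > 0`.
[cite: DKLM2026SixVertexGFF, Part II, Definition 29 (ii)] -/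
theorem dklmSpaceM_bound_ii (h : ν ∈ dklmSpaceM c C) {α β : ℝ} (hα : 0 < α) (hαβ : α ≤ β) :
    ν {p | p.1 ∈ Ioo 0 α ∧ |p.2| ∈ Ioo β (2 * β)} ≤ ENNReal.ofReal (C * (α / β) ^ c) :=
  h.2.2.2 α β hα hαβ

/-! ## 2. The domination function `a ∧ 1/a` -/

/-- The dyadic strips `S_j := {2^j < a ≤ 2^{j+1}}` of the right half-plane. [folklore] -/
def aStrip (j : ℤ) : Set (ℝ × ℝ) := {p | p.1 ∈ Ioc ((2 : ℝ) ^ j) ((2 : ℝ) ^ (j + 1))}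

/-- The dyadic strips are measurable. [folklore] -/
theorem measurableSet_aStrip (j : ℤ) : MeasurableSet (aStrip j) :=
  measurableSet_Ioc.preimage measurable_fst

/-- The dyadic strips `S_j = {2^j < a ≤ 2^{j+1}}` have mass `≤ 2C` (two instances of bound (i)).
[cite: DKLM2026SixVertexGFF, Part II, Definition 29 (i)] -/
theorem dklmSpaceM_measure_dyadic_le (h : ν ∈ dklmSpaceM c C) (j : ℤ) :
    ν (aStrip j) ≤ 2 * ENNReal.ofReal C := by
  have h2j : (0 : ℝ) < 2 ^ j := zpow_pos (by norm_num) j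
  calc ν (aStrip j)
      ≤ ν ({p | p.1 ∈ Ioo ((2 : ℝ) ^ j) (2 * 2 ^ j)} ∪ {p | p.1 ∈ Ioo ((3 / 2) * (2 : ℝ) ^ j) (2 * ((3 / 2) * 2 ^ j))}) := by
        refine measure_mono fun p hp => ?_
        simp only [aStrip, mem_setOf_eq, mem_Ioc, zpow_add_one₀ (two_ne_zero (α := ℝ))] at hp
        simp only [mem_union, mem_setOf_eq, mem_Ioo]
        by_cases hlt : p.1 < 2 * 2 ^ j
        · exact Or.inl ⟨hp.1, hlt⟩
        · right; constructor <;> nlinarith [hp.2]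
    _ ≤ ν {p | p.1 ∈ Ioo ((2 : ℝ) ^ j) (2 * 2 ^ j)} + ν {p | p.1 ∈ Ioo ((3 / 2) * (2 : ℝ) ^ j) (2 * ((3 / 2) * 2 ^ j))} :=
        measure_union_le _ _
    _ ≤ ENNReal.ofReal C + ENNReal.ofReal C := add_le_add (dklmSpaceM_bound_i h h2j) (dklmSpaceM_bound_i h (by positivity))
    _ = 2 * ENNReal.ofReal C := (two_mul _).symm

/-- On the strip `S_j`, `a ∧ 1/a ≤ 2 · 2^{-|j|}`. [folklore] -/
theorem min_inv_le_of_mem_dyadic {a : ℝ} {j : ℤ} (ha : a ∈ Ioc ((2 : ℝ) ^ j) ((2 : ℝ) ^ (j + 1))) :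
    min a a⁻¹ ≤ 2 * (2 : ℝ) ^ (-|j|) := by
  have h2j : (0 : ℝ) < 2 ^ j := zpow_pos (by norm_num) j
  have ha0 : 0 < a := h2j.trans ha.1
  rcases le_or_gt 0 j with hj | hj
  · -- `j ≥ 0`: `1/a < 2^{-j}`
    rw [abs_of_nonneg hj]
    calc min a a⁻¹ ≤ a⁻¹ := min_le_right _ _
      _ ≤ ((2 : ℝ) ^ j)⁻¹ := by rw [inv_le_inv₀ ha0 h2j]; exact ha.1.le
      _ = (2 : ℝ) ^ (-j) := (zpow_neg _ _).symm
      _ ≤ 2 * (2 : ℝ) ^ (-j) := by linarith [zpow_pos (show (0 : ℝ) < 2 by norm_num) (-j)]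
  · -- `j < 0`: `a ≤ 2^{j+1} = 2 · 2^{-|j|}`
    rw [abs_of_neg hj, neg_neg]
    calc min a a⁻¹ ≤ a := min_le_left _ _
      _ ≤ (2 : ℝ) ^ (j + 1) := ha.2
      _ = 2 * (2 : ℝ) ^ j := by rw [zpow_add_one₀ (two_ne_zero (α := ℝ)), mul_comm]

/-- `∑_{j ∈ ℤ} 2^{-|j|} = 3` in `ℝ≥0∞`. [folklore] -/
theorem tsum_two_zpow_neg_abs : ∑' j : ℤ, ENNReal.ofReal ((2 : ℝ) ^ (-|j|)) = 3 := by
  have hgeom : ∑' n : ℕ, ENNReal.ofReal ((2 : ℝ) ^ (-(n : ℤ))) = 2 := by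
    have : ∀ n : ℕ, ENNReal.ofReal ((2 : ℝ) ^ (-(n : ℤ))) = (2⁻¹ : ENNReal) ^ n := by
      intro n
      rw [zpow_neg, zpow_natCast, ← inv_pow, ENNReal.ofReal_pow (by norm_num), ENNReal.ofReal_inv_of_pos (by norm_num),
        ENNReal.ofReal_ofNat]
    simp_rw [this, ENNReal.tsum_geometric, ENNReal.one_sub_inv_two, inv_inv]
  rw [tsum_of_nat_of_neg_add_one ENNReal.summable ENNReal.summable]
  have h1 : ∀ n : ℕ, ENNReal.ofReal ((2 : ℝ) ^ (-|((n : ℕ) : ℤ)|)) = ENNReal.ofReal ((2 : ℝ) ^ (-(n : ℤ))) := by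
    intro n; rw [Int.abs_natCast]
  have h2 : ∀ n : ℕ, ENNReal.ofReal ((2 : ℝ) ^ (-|(-((n : ℤ) + 1))|)) =
      2⁻¹ * ENNReal.ofReal ((2 : ℝ) ^ (-(n : ℤ))) := by
    intro n
    rw [abs_neg, show ((n : ℤ) + 1) = ((n + 1 : ℕ) : ℤ) by push_cast; ring, Int.abs_natCast,
      show (-((n + 1 : ℕ) : ℤ)) = -(n : ℤ) + (-1) by push_cast; ring, zpow_add₀ (two_ne_zero (α := ℝ)),
      ENNReal.ofReal_mul (zpow_pos (by norm_num) _).le, mul_comm, zpow_neg_one,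
      ENNReal.ofReal_inv_of_pos (by norm_num), ENNReal.ofReal_ofNat]
  simp_rw [h1, h2, ENNReal.tsum_mul_left, hgeom]
  rw [ENNReal.inv_mul_cancel (by norm_num) (by norm_num)]
  norm_num

/-- **The domination bound `sup_{ν ∈ 𝓜} ∫ (a ∧ 1/a) dν < ∞`**, quantitatively:
`∫ (a ∧ 1/a) dν ≤ 12 C` for every `ν ∈ 𝓜_{c,C}` (dyadic decomposition in `a`, two uses of bound
(i) per strip). [cite: DKLM2026SixVertexGFF, Part II §1.2.1, eq. after Lemma 30] -/
theorem dklmSpaceM_lintegral_min_inv_le (h : ν ∈ dklmSpaceM c C) :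
    ∫⁻ p, ENNReal.ofReal (min p.1 p.1⁻¹) ∂ν ≤ 12 * ENNReal.ofReal C := by
  -- pointwise: `a ∧ 1/a ≤ ∑_j 2·2^{-|j|} 𝟙_{S_j}(a)`
  set S : ℤ → Set (ℝ × ℝ) := aStrip with hS
  have hmeas : ∀ j, MeasurableSet (S j) := measurableSet_aStrip
  have hpt : ∀ p : ℝ × ℝ, ENNReal.ofReal (min p.1 p.1⁻¹) ≤
      ∑' j : ℤ, ENNReal.ofReal (2 * (2 : ℝ) ^ (-|j|)) * (S j).indicator 1 p := by
    intro p
    rcases le_or_gt p.1 0 with hp | hp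
    · rw [ENNReal.ofReal_of_nonpos ((min_le_left _ _).trans hp)]; exact zero_le
    · obtain ⟨j, hj⟩ := exists_mem_Ioc_zpow hp (one_lt_two (α := ℝ))
      calc ENNReal.ofReal (min p.1 p.1⁻¹) ≤ ENNReal.ofReal (2 * (2 : ℝ) ^ (-|j|)) :=
            ENNReal.ofReal_le_ofReal (min_inv_le_of_mem_dyadic hj)
        _ = ENNReal.ofReal (2 * (2 : ℝ) ^ (-|j|)) * (S j).indicator 1 p := by
            rw [indicator_of_mem (show p ∈ S j from hj), Pi.one_apply, mul_one]
        _ ≤ ∑' j : ℤ, ENNReal.ofReal (2 * (2 : ℝ) ^ (-|j|)) * (S j).indicator 1 p :=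
            ENNReal.le_tsum j
  calc ∫⁻ p, ENNReal.ofReal (min p.1 p.1⁻¹) ∂ν
      ≤ ∫⁻ p, ∑' j : ℤ, ENNReal.ofReal (2 * (2 : ℝ) ^ (-|j|)) * (S j).indicator 1 p ∂ν := lintegral_mono hpt
    _ = ∑' j : ℤ, ∫⁻ p, ENNReal.ofReal (2 * (2 : ℝ) ^ (-|j|)) * (S j).indicator 1 p ∂ν :=
        lintegral_tsum fun j => ((measurable_one.indicator (hmeas j)).const_mul _).aemeasurable
    _ = ∑' j : ℤ, ENNReal.ofReal (2 * (2 : ℝ) ^ (-|j|)) * ν (S j) := by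
        refine tsum_congr fun j => ?_
        rw [lintegral_const_mul _ (measurable_one.indicator (hmeas j)), lintegral_indicator_one (hmeas j)]
    _ ≤ ∑' j : ℤ, ENNReal.ofReal (2 * (2 : ℝ) ^ (-|j|)) * (2 * ENNReal.ofReal C) :=
        ENNReal.tsum_le_tsum fun j => by gcongr; exact dklmSpaceM_measure_dyadic_le h j
    _ = 12 * ENNReal.ofReal C := by
        rw [ENNReal.tsum_mul_right]
        have : ∑' j : ℤ, ENNReal.ofReal (2 * (2 : ℝ) ^ (-|j|)) = 2 * 3 := by
          rw [← tsum_two_zpow_neg_abs, ← ENNReal.tsum_mul_left]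
          refine tsum_congr fun j => ?_
          rw [ENNReal.ofReal_mul zero_le_two, ENNReal.ofReal_ofNat]
        rw [this]
        ring

/-! ## 3. Scaling `ν ↦ ν^{(δ)}` (§1.2.3) -/

/-- **`ν^{(δ)}(U) := ν(δU)`**, i.e. the push-forward of `ν` under `p ↦ p/δ`.
[cite: DKLM2026SixVertexGFF, Part II §1.2.3] -/
def scaleMeasure (δ : ℝ) (ν : Measure (ℝ × ℝ)) : Measure (ℝ × ℝ) :=
  ν.map (fun p : ℝ × ℝ => δ⁻¹ • p)

/-- Dilations of the plane are measurable. [folklore] -/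
theorem measurable_smul_pair (t : ℝ) : Measurable (fun p : ℝ × ℝ => t • p) :=
  measurable_const_smul t

/-- `ν^{(δ)}(U) = ν(δU)`. [cite: DKLM2026SixVertexGFF, Part II §1.2.3] -/
theorem scaleMeasure_apply {δ : ℝ} (hδ : 0 < δ) (ν : Measure (ℝ × ℝ)) {U : Set (ℝ × ℝ)}
    (hU : MeasurableSet U) : scaleMeasure δ ν U = ν ((fun p : ℝ × ℝ => δ • p) '' U) := by
  rw [scaleMeasure, Measure.map_apply (measurable_smul_pair _) hU]
  congr 1
  ext p
  simp only [mem_preimage, mem_image]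
  constructor
  · intro hp; exact ⟨δ⁻¹ • p, hp, by rw [smul_smul, mul_inv_cancel₀ hδ.ne', one_smul]⟩
  · rintro ⟨q, hq, rfl⟩; rwa [smul_smul, inv_mul_cancel₀ hδ.ne', one_smul]

/-- **Change of variables**: `∫ f(δp) dν^{(δ)}(p) = ∫ f dν` (Lebesgue integral of a measurable
`f ≥ 0`). [cite: DKLM2026SixVertexGFF, Part II §1.2.3] -/
theorem lintegral_comp_scaleMeasure {δ : ℝ} (hδ : 0 < δ) (ν : Measure (ℝ × ℝ)) {f : ℝ × ℝ → ENNReal}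
    (hf : Measurable f) : ∫⁻ p, f (δ • p) ∂scaleMeasure δ ν = ∫⁻ p, f p ∂ν := by
  have h := lintegral_map (μ := ν) (hf.comp (measurable_smul_pair δ)) (measurable_smul_pair δ⁻¹)
  simp only [Function.comp_apply, smul_smul, mul_inv_cancel₀ hδ.ne', one_smul] at h
  rw [scaleMeasure]
  exact h

/-- **Change of variables** for the Bochner integral: `∫ g dν^{(δ)} = ∫ g(p/δ) dν(p)`.
[cite: DKLM2026SixVertexGFF, Part II §1.2.3] -/
theorem integral_scaleMeasure (δ : ℝ) (ν : Measure (ℝ × ℝ)) {g : ℝ × ℝ → ℂ}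
    (hg : AEStronglyMeasurable g (scaleMeasure δ ν)) :
    ∫ p, g p ∂scaleMeasure δ ν = ∫ p, g (δ⁻¹ • p) ∂ν :=
  integral_map (measurable_smul_pair _).aemeasurable hg

/-- **`𝓜_{c,C}` is scale invariant**: `ν ∈ 𝓜 ⇒ ν^{(δ)} ∈ 𝓜` for `δ > 0` (the bounds (i), (ii) only
involve the scale-invariant families `{a ∈ (α,2α)}`, `{(a,|b|) ∈ (0,α) × (β,2β)}`).
[cite: DKLM2026SixVertexGFF, Part II §1.2.3 ("denote by `ν^{(δ)} ∈ 𝓜` the measure …")] -/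
theorem scaleMeasure_mem_dklmSpaceM {δ : ℝ} (hδ : 0 < δ) (h : ν ∈ dklmSpaceM c C) :
    scaleMeasure δ ν ∈ dklmSpaceM c C := by
  have hm := measurable_smul_pair δ⁻¹
  have hδ' : 0 < δ⁻¹ := inv_pos.2 hδ
  refine ⟨?_, ?_, fun α hα => ?_, fun α β hα hαβ => ?_⟩
  · rw [scaleMeasure, Measure.map_apply hm (measurableSet_le measurable_fst measurable_const)]
    have : (fun p : ℝ × ℝ => δ⁻¹ • p) ⁻¹' {p : ℝ × ℝ | p.1 ≤ 0} = {p | p.1 ≤ 0} := by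
      ext p
      simp only [mem_preimage, mem_setOf_eq, Prod.smul_fst, smul_eq_mul]
      constructor
      · intro hp; nlinarith [mul_pos_iff.1 (show 0 < δ⁻¹ * δ by rw [inv_mul_cancel₀ hδ.ne']; exact one_pos)]
      · intro hp; exact mul_nonpos_of_nonneg_of_nonpos hδ'.le hp
    rw [this, dklmSpaceM_nonpos_null h]
  · have hσ : Measurable (fun p : ℝ × ℝ => (p.1, -p.2)) := measurable_fst.prodMk measurable_snd.neg
    rw [scaleMeasure, Measure.map_map hσ hm]
    have hcomm : (fun p : ℝ × ℝ => (p.1, -p.2)) ∘ (fun p : ℝ × ℝ => δ⁻¹ • p) =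
        (fun p : ℝ × ℝ => δ⁻¹ • p) ∘ (fun p : ℝ × ℝ => (p.1, -p.2)) := by
      funext p; simp
    rw [hcomm, ← Measure.map_map hm hσ, dklmSpaceM_map_reflect h]
  · rw [scaleMeasure, Measure.map_apply hm
      (show MeasurableSet {p : ℝ × ℝ | p.1 ∈ Ioo α (2 * α)} from measurableSet_Ioo.preimage measurable_fst)]
    have : (fun p : ℝ × ℝ => δ⁻¹ • p) ⁻¹' {p : ℝ × ℝ | p.1 ∈ Ioo α (2 * α)} = {p | p.1 ∈ Ioo (δ * α) (2 * (δ * α))} := by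
      ext p
      simp only [mem_preimage, mem_setOf_eq, Prod.smul_fst, smul_eq_mul, mem_Ioo]
      rw [← div_eq_inv_mul, lt_div_iff₀ hδ, div_lt_iff₀ hδ]
      constructor <;> rintro ⟨h1, h2⟩ <;> constructor <;> linarith
    rw [this]
    exact dklmSpaceM_bound_i h (mul_pos hδ hα)
  · have hmeas : MeasurableSet {p : ℝ × ℝ | p.1 ∈ Ioo 0 α ∧ |p.2| ∈ Ioo β (2 * β)} :=
      (measurableSet_Ioo.preimage measurable_fst).inter
        (measurableSet_Ioo.preimage (continuous_abs.measurable.comp measurable_snd))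
    rw [scaleMeasure, Measure.map_apply hm hmeas]
    have : (fun p : ℝ × ℝ => δ⁻¹ • p) ⁻¹' {p : ℝ × ℝ | p.1 ∈ Ioo 0 α ∧ |p.2| ∈ Ioo β (2 * β)} =
        {p | p.1 ∈ Ioo 0 (δ * α) ∧ |p.2| ∈ Ioo (δ * β) (2 * (δ * β))} := by
      ext p
      simp only [mem_preimage, mem_setOf_eq, Prod.smul_fst, Prod.smul_snd, smul_eq_mul, mem_Ioo, abs_mul,
        abs_of_pos hδ']
      rw [← div_eq_inv_mul, ← div_eq_inv_mul, lt_div_iff₀ hδ, div_lt_iff₀ hδ, lt_div_iff₀ hδ, div_lt_iff₀ hδ]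
      constructor
      · rintro ⟨⟨h1, h2⟩, h3, h4⟩; exact ⟨⟨by linarith, by linarith⟩, by linarith, by linarith⟩
      · rintro ⟨⟨h1, h2⟩, h3, h4⟩; exact ⟨⟨by linarith, by linarith⟩, by linarith, by linarith⟩
    rw [this]
    have hb := dklmSpaceM_bound_ii h (mul_pos hδ hα) (mul_le_mul_of_nonneg_left hαβ hδ.le)
    rwa [mul_div_mul_left _ _ hδ.ne'] at hb

end Literature.Probability.LatticeModels.SixVertex

end
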